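import Mathlib
import Summits.ValiantsHypothesis.ValiantsHypothesis.Theorems.LacunarySymmetroidMatrixDescartesTieLawSectorDefs
import HarnessLib

/-!
# ValiantsHypothesis / LacunarySymmetroid — crux `MatrixDescartes` (stmt-ValiantsHypothesis-18050, V1), LINE (A) «product_plus_one»:
# the TIE LAW, kernel path Stage 2, part 3a — rotations, the trinomial sector, the trinomial family

Elementary facts used by the complex-plane argument of the §45 proof (pen val-idea-25 g8, HOME NOTE §45): `rot θ = e^{iθ}`
(real/imaginary parts, products, powers, conjugate, `e^{2πi/c}` primitive), openness / disjointness / boundary description of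
`trinSector c = {0 < arg ζ < 2π/c}` and its exterior (all via sign conditions on imaginary parts — no `Complex.arg`), the signs
`0 < sin(2π/c)`, `0 < sin(2πa/c)` (`2a < c`) and the exterior position of the `c`-th roots of unity `e^{2πik/c}`, `2 ≤ k < c`,
and the deformation family `g_s = γ X^c + s X^a − β` (evaluation, degree, top coefficient, continuity of coefficients in `s`,
no root on the open ray `arg ζ = 2π/c` for `s > 0`, simplicity of positive real roots).  The root count (I5) itself is in
`…TieLawTrinomial`.
HONEST FRAMING: helper lemmas; no stub of LINE (A) is touched; `MatrixDescartes` OPEN; `VP ≠ VNP` is NOT proved.  No definitions,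
no named facts.
-/

set_option linter.dupNamespace false

namespace Summit.ValiantsHypothesis.ValiantsHypothesis.Theorems.LacunarySymmetroidMatrixDescartes

namespace TieLaw

open Polynomial Filter Topology

/-! ### Rotations -/

/-- `Im e^{iθ} = sin θ`. -/
theorem rot_im (θ : ℝ) : (rot θ).im = Real.sin θ := by
  simp [rot, Complex.exp_ofReal_mul_I_im]

/-- `Re e^{iθ} = cos θ`. -/
theorem rot_re (θ : ℝ) : (rot θ).re = Real.cos θ := by
  simp [rot, Complex.exp_ofReal_mul_I_re]

/-- `‖e^{iθ}‖ = 1`. -/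
theorem norm_rot (θ : ℝ) : ‖rot θ‖ = 1 := by
  simp [rot, Complex.norm_exp_ofReal_mul_I]

/-- `e^{iθ} ≠ 0`. -/
theorem rot_ne_zero (θ : ℝ) : rot θ ≠ 0 := by
  simp [rot, Complex.exp_ne_zero]

/-- `e^{i(θ₁+θ₂)} = e^{iθ₁} e^{iθ₂}`. -/
theorem rot_add (θ₁ θ₂ : ℝ) : rot (θ₁ + θ₂) = rot θ₁ * rot θ₂ := by
  simp only [rot, ← Complex.exp_add]
  push_cast
  ring_nf

/-- `e^{i0} = 1`. -/
private theorem rot_zero : rot 0 = 1 := by simp [rot]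

/-- `e^{−iθ} e^{iθ} = 1`. -/
theorem rot_neg_mul_rot (θ : ℝ) : rot (-θ) * rot θ = 1 := by
  rw [← rot_add, neg_add_cancel, rot_zero]

/-- `e^{iθ} e^{−iθ} = 1`. -/
theorem rot_mul_rot_neg (θ : ℝ) : rot θ * rot (-θ) = 1 := by
  rw [← rot_add, add_neg_cancel, rot_zero]

/-- `e^{inθ} = (e^{iθ})^n`. -/
theorem rot_nat_mul (n : ℕ) (θ : ℝ) : rot (n * θ) = rot θ ^ n := by
  simp only [rot, ← Complex.exp_nat_mul]
  push_cast
  ring_nf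

/-- `conj e^{iθ} = e^{−iθ}`. -/
theorem conj_rot (θ : ℝ) : (starRingEnd ℂ) (rot θ) = rot (-θ) := by
  simp only [rot, ← Complex.exp_conj, map_mul, Complex.conj_ofReal, Complex.conj_I]
  push_cast
  ring_nf

/-- `Im(t e^{iθ}) = t sin θ` for real `t`. -/
theorem im_ofReal_mul_rot (t θ : ℝ) : ((t : ℂ) * rot θ).im = t * Real.sin θ := by
  rw [Complex.im_ofReal_mul, rot_im]

/-- `Im(e^{iθ} t) = sin θ · t` for real `t`. -/
theorem im_rot_mul_ofReal (θ t : ℝ) : (rot θ * (t : ℂ)).im = Real.sin θ * t := by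
  rw [Complex.im_mul_ofReal, rot_im]

/-- `e^{2πi/c}` is a primitive `c`-th root of unity. -/
theorem isPrimitiveRoot_rot (c : ℕ) (hc : c ≠ 0) : IsPrimitiveRoot (rot (2 * Real.pi / c)) c := by
  have h := Complex.isPrimitiveRoot_exp c hc
  convert h using 2
  simp only [rot]
  push_cast
  ring

/-- `(e^{2πi/c})^c = 1`. -/
theorem rot_two_pi_div_pow (c : ℕ) (hc : c ≠ 0) : rot (2 * Real.pi / c) ^ c = 1 :=
  (isPrimitiveRoot_rot c hc).pow_eq_one

/-- If `Im(z e^{−iθ}) = 0` then `z = u e^{iθ}` with `u = Re(z e^{−iθ})` real. -/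
theorem eq_ofReal_mul_rot_of_im_eq_zero {z : ℂ} {θ : ℝ} (hz : (z * rot (-θ)).im = 0) :
    z = ((z * rot (-θ)).re : ℂ) * rot θ := by
  have h1 : z = (z * rot (-θ)) * rot θ := by rw [mul_assoc, rot_neg_mul_rot, mul_one]
  have h2 : z * rot (-θ) = ((z * rot (-θ)).re : ℂ) := Complex.ext (by simp) (by simp [hz])
  conv_lhs => rw [h1, h2]

/-! ### The trinomial sector: openness, disjointness, boundary -/

/-- The trinomial sector is open. -/
theorem isOpen_trinSector (c : ℕ) : IsOpen (trinSector c) := by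
  have h1 : IsOpen {z : ℂ | 0 < z.im} := isOpen_lt continuous_const Complex.continuous_im
  have h2 : IsOpen {z : ℂ | (z * rot (-(2 * Real.pi / c))).im < 0} :=
    isOpen_lt (Complex.continuous_im.comp (continuous_id.mul continuous_const)) continuous_const
  exact h1.inter h2

/-- The exterior of the trinomial sector is open. -/
theorem isOpen_trinExterior (c : ℕ) : IsOpen (trinExterior c) := by
  have h1 : IsOpen {z : ℂ | z.im < 0} := isOpen_lt Complex.continuous_im continuous_const
  have h2 : IsOpen {z : ℂ | 0 < (z * rot (-(2 * Real.pi / c))).im} :=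
    isOpen_lt continuous_const (Complex.continuous_im.comp (continuous_id.mul continuous_const))
  exact h1.union h2

/-- The sector and its exterior are disjoint. -/
theorem not_mem_trinSector_of_mem_trinExterior {c : ℕ} {z : ℂ} (hz : z ∈ trinExterior c) :
    z ∉ trinSector c := by
  rw [mem_trinExterior] at hz
  rw [mem_trinSector]
  rintro ⟨h1, h2⟩
  rcases hz with h | h <;> linarith

/-- Off the sector and its exterior, a point lies on one of the two closed boundary rays. -/
theorem boundary_of_not_mem_trin {c : ℕ} {z : ℂ} (h1 : z ∉ trinSector c) (h2 : z ∉ trinExterior c) :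
    (z.im = 0 ∧ (z * rot (-(2 * Real.pi / c))).im ≤ 0) ∨
      ((z * rot (-(2 * Real.pi / c))).im = 0 ∧ 0 ≤ z.im) := by
  rw [mem_trinSector, not_and_or] at h1
  rw [mem_trinExterior, not_or] at h2
  obtain ⟨h2a, h2b⟩ := h2
  push Not at h2a h2b
  rcases h1 with h | h
  · push Not at h
    exact Or.inl ⟨le_antisymm h h2a, h2b⟩
  · push Not at h
    exact Or.inr ⟨le_antisymm h2b h, h2a⟩

/-! ### Trigonometric signs -/

/-- `0 < sin(2π/c)` for `c > 2`. -/
theorem sin_two_pi_div_pos {c : ℕ} (hc : 2 < c) : 0 < Real.sin (2 * Real.pi / c) := by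
  have hc' : (2 : ℝ) < c := by exact_mod_cast hc
  apply Real.sin_pos_of_pos_of_lt_pi
  · positivity
  · rw [div_lt_iff₀ (by linarith)]
    nlinarith [Real.pi_pos]

/-- `0 < sin(2πa/c)` for `0 < a`, `2a < c`. -/
theorem sin_two_pi_mul_div_pos {a c : ℕ} (ha : 0 < a) (h2a : 2 * a < c) :
    0 < Real.sin (2 * Real.pi * a / c) := by
  have ha' : (0 : ℝ) < a := by exact_mod_cast ha
  have h2a' : (2 : ℝ) * a < c := by exact_mod_cast h2a
  have hc' : (0 : ℝ) < c := by linarith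
  apply Real.sin_pos_of_pos_of_lt_pi
  · positivity
  · rw [div_lt_iff₀ hc']
    nlinarith [Real.pi_pos]

/-- For `2 ≤ k < c`: `sin(2πk/c) < 0` or `0 < sin(2π(k−1)/c)` — the `c`-th roots of unity other than `1` and `e^{2πi/c}`
are exterior to the sector `{0 ≤ arg ≤ 2π/c}`. -/
theorem sin_exterior {c k : ℕ} (h2k : 2 ≤ k) (hkc : k < c) :
    Real.sin (k * (2 * Real.pi / c)) < 0 ∨ 0 < Real.sin (((k : ℝ) - 1) * (2 * Real.pi / c)) := by
  have hc' : (0 : ℝ) < c := by exact_mod_cast (lt_of_le_of_lt (Nat.zero_le _) hkc)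
  have hk' : (2 : ℝ) ≤ k := by exact_mod_cast h2k
  have hkc' : (k : ℝ) < c := by exact_mod_cast hkc
  by_cases hcase : 2 * ((k : ℝ) - 1) < c
  · right
    apply Real.sin_pos_of_pos_of_lt_pi
    · have : (0 : ℝ) < (k : ℝ) - 1 := by linarith
      positivity
    · rw [show ((k : ℝ) - 1) * (2 * Real.pi / c) = (2 * ((k : ℝ) - 1)) * Real.pi / c by ring,
        div_lt_iff₀ hc']
      nlinarith [Real.pi_pos]
  · left
    push Not at hcase
    -- π < 2πk/c < 2π
    have hlo : Real.pi < k * (2 * Real.pi / c) := by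
      rw [show (k : ℝ) * (2 * Real.pi / c) = (2 * k) * Real.pi / c by ring, lt_div_iff₀ hc']
      nlinarith [Real.pi_pos]
    have hhi : k * (2 * Real.pi / c) < 2 * Real.pi := by
      rw [show (k : ℝ) * (2 * Real.pi / c) = (2 * Real.pi) * (k / c) by ring]
      have : (k : ℝ) / c < 1 := (div_lt_one hc').2 hkc'
      nlinarith [Real.pi_pos]
    have := Real.sin_pos_of_pos_of_lt_pi (x := k * (2 * Real.pi / c) - Real.pi) (by linarith) (by linarith)
    rw [Real.sin_sub_pi] at this
    linarith

/-! ### The trinomial family `g_s = γ X^c + s X^a − β` -/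

section Trinomial

variable {a c : ℕ} {β γ : ℝ}

/-- The real deformation family. -/
theorem gFam_eval (s t : ℝ) (a c : ℕ) (β γ : ℝ) :
    (C γ * X ^ c + C s * X ^ a - C β : ℝ[X]).eval t = γ * t ^ c + s * t ^ a - β := by
  simp [eval_add, eval_sub, eval_mul, eval_pow, eval_C, eval_X]

/-- The complexified family is `A + s·B` with `A = γ X^c − β`, `B = X^a`. -/
theorem gFam_map (s : ℝ) (a c : ℕ) (β γ : ℝ) :
    (C γ * X ^ c + C s * X ^ a - C β : ℝ[X]).map (algebraMap ℝ ℂ) =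
      (C (γ : ℂ) * X ^ c - C (β : ℂ)) + C (s : ℂ) * X ^ a := by
  simp only [Polynomial.map_add, Polynomial.map_sub, Polynomial.map_mul, Polynomial.map_pow, map_C, map_X]
  simp only [Complex.coe_algebraMap]
  ring

/-- Evaluation of the complexified family. -/
theorem gFamC_eval (s : ℝ) (a c : ℕ) (β γ : ℝ) (z : ℂ) :
    ((C (γ : ℂ) * X ^ c - C (β : ℂ)) + C (s : ℂ) * X ^ a).eval z = γ * z ^ c - β + s * z ^ a := by
  simp [eval_add, eval_sub, eval_mul, eval_pow, eval_C, eval_X]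

/-- Degree bound of the complexified family (`a < c`). -/
theorem gFamC_natDegree_le (hac : a < c) (s : ℝ) (β γ : ℝ) :
    ((C (γ : ℂ) * X ^ c - C (β : ℂ)) + C (s : ℂ) * X ^ a).natDegree ≤ c := by
  refine (natDegree_add_le _ _).trans (max_le ?_ ?_)
  · refine (natDegree_sub_le _ _).trans (max_le ?_ ?_)
    · exact (natDegree_C_mul_le _ _).trans (natDegree_X_pow_le _)
    · exact (natDegree_C _).le.trans (Nat.zero_le _)
  · exact (natDegree_C_mul_le _ _).trans ((natDegree_X_pow_le _).trans hac.le)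

/-- Top coefficient of the complexified family is `γ` (`a < c`). -/
theorem gFamC_coeff_top (hac : a < c) (s : ℝ) (β γ : ℝ) :
    ((C (γ : ℂ) * X ^ c - C (β : ℂ)) + C (s : ℂ) * X ^ a).coeff c = (γ : ℂ) := by
  have hc0 : c ≠ 0 := by omega
  simp [coeff_add, coeff_sub, coeff_C_mul, coeff_X_pow, coeff_C, hc0, hac.ne']

/-- Coefficients of the complexified family depend continuously (affinely) on `s`. -/
theorem gFamC_coeff_continuous (a c : ℕ) (β γ : ℝ) (k : ℕ) :
    Continuous fun s : ℝ => (((C (γ : ℂ) * X ^ c - C (β : ℂ)) + C (s : ℂ) * X ^ a).coeff k) := by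
  simp only [coeff_add, coeff_sub, coeff_C_mul, coeff_X_pow, coeff_C]
  fun_prop

/-- No root of `g_s` (`s > 0`, `0 < a`, `2a < c`) lies on the open ray `arg ζ = 2π/c`: there
`Im g_s(u e^{2πi/c}) = s u^a sin(2πa/c) > 0`. -/
theorem gFamC_eval_ray_ne_zero (ha : 0 < a) (h2a : 2 * a < c) {s : ℝ} (hs : 0 < s) (β γ : ℝ) {u : ℝ}
    (hu : 0 < u) :
    ((C (γ : ℂ) * X ^ c - C (β : ℂ)) + C (s : ℂ) * X ^ a).eval ((u : ℂ) * rot (2 * Real.pi / c)) ≠ 0 := by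
  have hc0 : c ≠ 0 := by omega
  rw [gFamC_eval]
  intro h0
  have him := congrArg Complex.im h0
  rw [mul_pow, mul_pow, rot_two_pi_div_pow c hc0, ← rot_nat_mul a] at him
  have e1 : ((γ : ℂ) * ((u : ℂ) ^ c * 1) - β + s * ((u : ℂ) ^ a * rot (a * (2 * Real.pi / c)))).im =
      s * u ^ a * Real.sin (a * (2 * Real.pi / c)) := by
    have : ((u : ℂ) ^ a * rot (a * (2 * Real.pi / c))) = ((u ^ a : ℝ) : ℂ) * rot (a * (2 * Real.pi / c)) := by
      push_cast; ring
    rw [this, Complex.add_im, Complex.sub_im]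
    rw [show ((γ : ℂ) * ((u : ℂ) ^ c * 1)) = ((γ * u ^ c : ℝ) : ℂ) by push_cast; ring, Complex.ofReal_im,
      Complex.ofReal_im]
    rw [show (s : ℂ) * (((u ^ a : ℝ) : ℂ) * rot (a * (2 * Real.pi / c))) =
      ((s * u ^ a : ℝ) : ℂ) * rot (a * (2 * Real.pi / c)) by push_cast; ring, im_ofReal_mul_rot]
    ring
  rw [e1, Complex.zero_im] at him
  have hsin : 0 < Real.sin (a * (2 * Real.pi / c)) := by
    rw [show (a : ℝ) * (2 * Real.pi / c) = 2 * Real.pi * a / c by ring]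
    exact sin_two_pi_mul_div_pos ha h2a
  have : 0 < s * u ^ a * Real.sin (a * (2 * Real.pi / c)) := by positivity
  linarith

/-- A positive real root of the real trinomial `g_s` (`s ≥ 0`, `γ > 0`, `0 < c`) is simple: `g_s′(t) > 0`. -/
theorem gFam_derivative_eval_pos (hc : 0 < c) (hγ : 0 < γ) {s : ℝ} (hs : 0 ≤ s) (β : ℝ) {t : ℝ} (ht : 0 < t) :
    0 < (C γ * X ^ c + C s * X ^ a - C β : ℝ[X]).derivative.eval t := by
  simp only [derivative_add, derivative_sub, derivative_C_mul, derivative_X_pow, derivative_C, sub_zero,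
    eval_add, eval_mul, eval_C, eval_pow, eval_X]
  have h1 : 0 < γ * ((c : ℝ) * t ^ (c - 1)) := by
    have : (0 : ℝ) < c := by exact_mod_cast hc
    positivity
  have h2 : 0 ≤ s * ((a : ℝ) * t ^ (a - 1)) := by positivity
  linarith

/-- Degree bound of the real family (`a < c`). -/
theorem gFam_natDegree_le (hac : a < c) (s β γ : ℝ) :
    (C γ * X ^ c + C s * X ^ a - C β : ℝ[X]).natDegree ≤ c := by
  refine (natDegree_sub_le _ _).trans (max_le ?_ ?_)
  · refine (natDegree_add_le _ _).trans (max_le ?_ ?_)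
    · exact (natDegree_C_mul_le _ _).trans (natDegree_X_pow_le _)
    · exact (natDegree_C_mul_le _ _).trans ((natDegree_X_pow_le _).trans hac.le)
  · exact (natDegree_C _).le.trans (Nat.zero_le _)

/-- Coefficients of the real family depend continuously on `s`. -/
theorem gFam_coeff_continuous (a c : ℕ) (β γ : ℝ) (k : ℕ) :
    Continuous fun s : ℝ => ((C γ * X ^ c + C s * X ^ a - C β : ℝ[X]).coeff k) := by
  simp only [coeff_add, coeff_sub, coeff_C_mul, coeff_X_pow, coeff_C]
  fun_prop

/-- Evaluation of the complexified family at a real point. -/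
theorem gFamC_eval_ofReal (s : ℝ) (a c : ℕ) (β γ t : ℝ) :
    ((C (γ : ℂ) * X ^ c - C (β : ℂ)) + C (s : ℂ) * X ^ a).eval (t : ℂ) =
      ((γ * t ^ c + s * t ^ a - β : ℝ) : ℂ) := by
  rw [gFamC_eval]
  push_cast
  ring

end Trinomial

end TieLaw

end Summit.ValiantsHypothesis.ValiantsHypothesis.Theorems.LacunarySymmetroidMatrixDescartes
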